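import Summits.ABC.IUTFork.Joshi.InitialThetaDataJoshiProofs
import HarnessLib

/-!
# [J-III] Lemma 3.4.2.1 / [J-IV] Lemma 6.3.2 in CONSUMER FORM: `[L' : L] ≤ ℓ⁴` for Joshi's Initial Theta Data

Proof-only companion (theorems only; no definition, no named fact, no instance) of `Joshi/InitialThetaDataJoshi.lean`
(abc-iut-E-t6, p428841) and `Joshi/InitialThetaDataJoshiProofs.lean` (p430563), rung LADDER-ABC:A2.E. TAKES NO SIDE on
[IUTchIII] Cor. 3.12 or on any author; typed ≠ proved. Purpose: the [J-IV] E5 files read the degree bound «`[L′ : L] ≤ ℓ⁴`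
by Lemma 6.3.2» (K. Joshi, arXiv:2403.10430v2: Lem. 6.3.2 p.59 l.1–9 «`Gal(L′/L) ↪ GL₂(𝔽_ℓ)`, `|GL₂(𝔽_ℓ)| = ℓ(ℓ+1)(ℓ−1)² ≤ ℓ⁴`»;
used in Lem. 6.4.2 p.60 l.26–27 = E-t30's `MainBoundDatum.DegLpLBound` and in (6.10.6) p.68 l.41 = E-t31's
`PrimeTowerDatum.Eq6106`) as a HYPOTHESIS on an abstract degree `degLpL`. For Joshi's typed data
`D : ATS3.InitialThetaData L L' Lbar C ℓ` ([J-III] §3.1/§3.3) that bound is a THEOREM: `lemma3421_holds` (p430563: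
`L'/L` finite, `[L':L] ≤ |GL₂(ℤ/ℓ)|`, via the Galois representation on `C[ℓ](L̄)`) and `card_GL_two_lt` (p428841:
`|GL₂(ℤ/ℓ)| < ℓ⁴`). This file states it with EXPLICIT arguments (the landed `Lemma3421` has its parameters `L`, `L'`, `ℓ`
implicit), in the two shapes the consumers instantiate: `finiteDimensional`, `finrank_le_card_GL_two`, `finrank_le_pow_four`,
`finrank_lt_pow_four`, and the real-logarithm form `log_finrank_le` («`log([L′:L]) ≤ 4·log ℓ`», p.60 l.27–28). As in
`lemma3421_holds`, `L̄` is taken in the universe of `L`. [claim: Joshi2024ATS3, status: disputed] [claim: Joshi2024ATS4, status: disputed]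
-/

noncomputable section

open scoped Classical

universe u v

namespace Summit.ABC.IUTFork.Joshi.ATS3.InitialThetaData

variable {L : Type u} {L' : Type v} {Lbar : Type u} [Field L] [NumberField L] [Field L'] [NumberField L']
  [Algebra L L'] [Field Lbar] [Algebra L Lbar] [Algebra L' Lbar] {C : WeierstrassCurve L} [C.IsElliptic]
  {ℓ : ℕ} (D : InitialThetaData L L' Lbar C ℓ)

include D

/-- `L'/L` is a finite extension ([J-III] Lem. 3.4.2.1). PROVED. [claim: Joshi2024ATS3, status: disputed] -/
theorem finiteDimensional : FiniteDimensional L L' := D.lemma3421_holds.1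

/-- `[L' : L] ≤ |GL₂(ℤ/ℓ)|` ([J-III] Lem. 3.4.2.1; [J-IV] Lem. 6.3.2 «`Gal(L′/L) ↪ GL₂(𝔽_ℓ)`»). PROVED.
[claim: Joshi2024ATS3, status: disputed] -/
theorem finrank_le_card_GL_two : Module.finrank L L' ≤ Nat.card (GL (Fin 2) (ZMod ℓ)) := D.lemma3421_holds.2

/-- `[L' : L] < ℓ⁴` (`|GL₂(𝔽_ℓ)| = (ℓ²−1)(ℓ²−ℓ) < ℓ⁴`). PROVED. [claim: Joshi2024ATS3, status: disputed] -/
theorem finrank_lt_pow_four : Module.finrank L L' < ℓ ^ 4 :=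
  lt_of_le_of_lt D.finrank_le_card_GL_two D.card_GL_two_lt

/-- **`[L' : L] ≤ ℓ⁴`** — [J-IV] Lem. 6.3.2 / Lem. 6.4.2 p.60 l.26–27 «as `[L′ : L] ≤ ℓ⁴` by Lemma 6.3.2»; the hypothesis
`MainBoundDatum.DegLpLBound` (E-t30) and the factor of (6.10.6) (E-t31), DISCHARGED for Joshi's data. PROVED.
[claim: Joshi2024ATS4, status: disputed] -/
theorem finrank_le_pow_four : Module.finrank L L' ≤ ℓ ^ 4 := D.finrank_lt_pow_four.le

/-- `1 ≤ [L' : L]` (a finite field extension has positive degree). PROVED. [folklore] -/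
theorem one_le_finrank : 1 ≤ Module.finrank L L' := by
  haveI := D.finiteDimensional
  exact Module.finrank_pos

/-- **`log([L′ : L]) ≤ 4·log(ℓ)`** ([J-IV] p.60 l.27–28 «one obtains the bound `log([L′ : L]) ≤ 4·log(ℓ)`»). PROVED.
[claim: Joshi2024ATS4, status: disputed] -/
theorem log_finrank_le : Real.log (Module.finrank L L' : ℝ) ≤ 4 * Real.log (ℓ : ℝ) := by
  have h1 : (1 : ℝ) ≤ (Module.finrank L L' : ℝ) := by exact_mod_cast D.one_le_finrank
  have h4 : (Module.finrank L L' : ℝ) ≤ (ℓ : ℝ) ^ 4 := by exact_mod_cast D.finrank_le_pow_four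
  calc Real.log (Module.finrank L L' : ℝ) ≤ Real.log ((ℓ : ℝ) ^ 4) := Real.log_le_log (by linarith) h4
    _ = 4 * Real.log (ℓ : ℝ) := by rw [Real.log_pow]; norm_num

end Summit.ABC.IUTFork.Joshi.ATS3.InitialThetaData

end
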